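import Summits.Ventures.Crystal3D.Theorems.StickyWulffConstantGenericWallFloorBarlowWindowFamily
import HarnessLib

/-!
# From LINE SETS to WINDOW FAMILIES: the lowest band vertex of each zigzag line (F4 glue, G-side)
# (crux `GenericWallFloor`, stmt-Ventures-19480, line `WallLedgerG`; lane T's F4 — matching `cell_charge_le_lines_sel`'s line sets
# with the start-site families of `bottomFamily_spec` / `topFamily_spec`)

HONEST FRAMING. Venture `Summits/Ventures/Crystal3D` (cell `crystal3d-full`), helper `--supports` the crux `GenericWallFloor`
(stmt-Ventures-19480) of `route-Ventures-StickyWulffConstant`, registered line `WallLedgerG`, open stub `stub_twoSlabAdhesion`.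
Rung credit only; F-C1 not moved; NOT the stub.  Pure bookkeeping on a polyline `vertex : ℤ → E3` with `vertex (k+1) = vertex k + ms k`,
`vertex k` a site of layer `k` (lane T's `zigVertexS step` in the orientation `axisSign = +1`), unit steps rising by `≥ δ > 0` along `z`
after the motion `p ↦ L p + s₀`.

Lane T indexes the walker families by LINES `t ∈ ℤ²` having SOME vertex `vertex k + t₀u + t₁v` in the height band `[H, H+1]` at lateral
radius `≤ ρw`; `bottomFamily_spec` wants START SITES: per line the LOWEST vertex of height `≥ H` (its predecessor is then below `H`).
This file performs the selection (`Int.exists_least_of_bdd` along the line — heights grow by `≥ δ` per step) and records its properties: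

* `height_vertex_mono` — `ht (vertex k + w) + n·δ ≤ ht (vertex (k+n) + w)`;
* **`lineFamily_spec`** — for a finite set `Tl` of lines each with a band vertex at lateral radius `≤ ρw`, there are index maps
  `mi ai bi : (Fin 2 → ℤ) → ℤ` such that for every `t ∈ Tl` the site `barlowPos σ (mi t) (ai t) (bi t)` equals `vertex (mi t) + t₀u + t₁v`,
  has height in `[H, H+1]`, its zigzag predecessor `· − ms (mi t − 1)` lies strictly below `H`, its lateral radius is `≤ ρw + 1/δ`,
  and distinct lines give distinct sites — exactly the inputs `hlow / hpred / hinjT / hlat` of `bottomFamily_spec` (with `ρin = ρw + 1/δ`).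
WHAT THIS IS NOT: not F4; F-C1 not moved.
-/

noncomputable section

namespace Summit.Ventures.Crystal3D.Theorems

open Finset
open Literature.MathematicalPhysics.StatisticalMechanics
open scoped InnerProductSpace

section Line

variable (σ : ℤ → ℤ) (L : EuclideanSpace ℝ (Fin 3) ≃ₗᵢ[ℝ] EuclideanSpace ℝ (Fin 3)) (s₀ z : EuclideanSpace ℝ (Fin 3))
  (ms : ℤ → EuclideanSpace ℝ (Fin 3)) (vertex : ℤ → EuclideanSpace ℝ (Fin 3))

/-- **Heights grow along the polyline**: `⟪L (vertex k + w) + s₀, z⟫ + n·δ ≤ ⟪L (vertex (k + n) + w) + s₀, z⟫`. -/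
theorem height_vertex_mono {δ : ℝ} (hδ : ∀ m, δ ≤ ⟪L (ms m), z⟫_ℝ) (hsucc : ∀ k, vertex (k + 1) = vertex k + ms k)
    (w : EuclideanSpace ℝ (Fin 3)) (k : ℤ) :
    ∀ n : ℕ, ⟪L (vertex k + w) + s₀, z⟫_ℝ + n * δ ≤ ⟪L (vertex (k + n) + w) + s₀, z⟫_ℝ := by
  intro n
  induction n with
  | zero => simp
  | succ n ih =>
    have e : vertex (k + ((n + 1 : ℕ) : ℤ)) + w = (vertex (k + n) + w) + ms (k + n) := by
      rw [show k + ((n + 1 : ℕ) : ℤ) = k + (n : ℤ) + 1 by push_cast; ring, hsucc]; abel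
    have e2 : ⟪L (vertex (k + ↑n) + w + ms (k + ↑n)) + s₀, z⟫_ℝ = ⟪L (vertex (k + ↑n) + w) + s₀, z⟫_ℝ + ⟪L (ms (k + ↑n)), z⟫_ℝ := by
      rw [map_add L (vertex (k + ↑n) + w) (ms (k + ↑n)), add_right_comm, inner_add_left]
    rw [e, e2]
    have := hδ (k + n)
    push_cast
    linarith

open scoped Classical in
/-- **Lowest band vertices of a line set form a window family.**  See the module docstring. -/
theorem lineFamily_spec {δ : ℝ} (hδ0 : 0 < δ) (hδ : ∀ m, δ ≤ ⟪L (ms m), z⟫_ℝ) (hms : ∀ m, ‖ms m‖ = 1)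
    (hsucc : ∀ k, vertex (k + 1) = vertex k + ms k) (hlayer : ∀ k, vertex k ∈ barlowLayer 1 (Real.sqrt (2 / 3)) σ k)
    (H ρw : ℝ) (Tl : Finset (Fin 2 → ℤ))
    (hwin : ∀ t ∈ Tl, ∃ k : ℤ,
      H ≤ ⟪L (vertex k + ((t 0 : ℝ) • triangularVec₁ 1 + (t 1 : ℝ) • triangularVec₂ 1)) + s₀, z⟫_ℝ ∧
      ⟪L (vertex k + ((t 0 : ℝ) • triangularVec₁ 1 + (t 1 : ℝ) • triangularVec₂ 1)) + s₀, z⟫_ℝ ≤ H + 1 ∧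
      Real.sqrt ((L (vertex k + ((t 0 : ℝ) • triangularVec₁ 1 + (t 1 : ℝ) • triangularVec₂ 1)) + s₀) 0 ^ 2 +
        (L (vertex k + ((t 0 : ℝ) • triangularVec₁ 1 + (t 1 : ℝ) • triangularVec₂ 1)) + s₀) 1 ^ 2) ≤ ρw) :
    ∃ mi ai bi : (Fin 2 → ℤ) → ℤ, ∀ t ∈ Tl,
      barlowPos 1 (Real.sqrt (2 / 3)) σ (mi t) (ai t) (bi t) = vertex (mi t) + ((t 0 : ℝ) • triangularVec₁ 1 + (t 1 : ℝ) • triangularVec₂ 1) ∧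
      H ≤ ⟪L (barlowPos 1 (Real.sqrt (2 / 3)) σ (mi t) (ai t) (bi t)) + s₀, z⟫_ℝ ∧
      ⟪L (barlowPos 1 (Real.sqrt (2 / 3)) σ (mi t) (ai t) (bi t)) + s₀, z⟫_ℝ ≤ H + 1 ∧
      ⟪L (barlowPos 1 (Real.sqrt (2 / 3)) σ (mi t) (ai t) (bi t) - ms (mi t - 1)) + s₀, z⟫_ℝ < H ∧
      Real.sqrt ((L (barlowPos 1 (Real.sqrt (2 / 3)) σ (mi t) (ai t) (bi t)) + s₀) 0 ^ 2 +
        (L (barlowPos 1 (Real.sqrt (2 / 3)) σ (mi t) (ai t) (bi t)) + s₀) 1 ^ 2) ≤ ρw + 1 / δ ∧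
      (∀ t' ∈ Tl, barlowPos 1 (Real.sqrt (2 / 3)) σ (mi t) (ai t) (bi t) = barlowPos 1 (Real.sqrt (2 / 3)) σ (mi t') (ai t') (bi t') →
        t = t') := by
  set uv : (Fin 2 → ℤ) → EuclideanSpace ℝ (Fin 3) := fun t => (t 0 : ℝ) • triangularVec₁ 1 + (t 1 : ℝ) • triangularVec₂ 1 with huv
  set ht : EuclideanSpace ℝ (Fin 3) → ℝ := fun p => ⟪L p + s₀, z⟫_ℝ with hht
  -- the lowest vertex of height ≥ H on each line
  have hleast : ∀ t ∈ Tl, ∃ k₀ : ℤ, H ≤ ht (vertex k₀ + uv t) ∧ ∀ k : ℤ, H ≤ ht (vertex k + uv t) → k₀ ≤ k := by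
    intro t ht'
    obtain ⟨kw, h1', h2', -⟩ := hwin t ht'
    have h1 : H ≤ ht (vertex kw + uv t) := h1'
    have h2 : ht (vertex kw + uv t) ≤ H + 1 := h2'
    refine Int.exists_least_of_bdd ⟨kw - (⌈1 / δ⌉ + 1), fun k hk => ?_⟩ ⟨kw, h1⟩
    by_contra hlt
    push Not at hlt
    have hceil : (0 : ℤ) ≤ ⌈(1 / δ : ℝ)⌉ := Int.ceil_nonneg (by positivity)
    -- `k` is more than `1/δ` steps below `kw`: its height is below `H`
    obtain ⟨n, hn⟩ := Int.eq_ofNat_of_zero_le (by omega : (0 : ℤ) ≤ kw - k)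
    have hmono := height_vertex_mono L s₀ z ms vertex hδ hsucc (uv t) k n
    rw [show k + (n : ℤ) = kw by omega] at hmono
    have hn1 : (1 / δ : ℝ) + 1 ≤ n := by
      have h3 : (⌈1 / δ⌉ : ℝ) + 1 < ((kw - k : ℤ) : ℝ) := by exact_mod_cast (by omega : ⌈1 / δ⌉ + 1 < kw - k)
      rw [hn] at h3; push_cast at h3
      have := Int.le_ceil (1 / δ); linarith
    have h4 : 1 + δ ≤ n * δ := by
      have := mul_le_mul_of_nonneg_right hn1 hδ0.le
      rw [add_mul, one_div, inv_mul_cancel₀ hδ0.ne'] at this; linarith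
    have : ht (vertex k + uv t) + n * δ ≤ ht (vertex kw + uv t) := hmono
    simp only [hht] at this hk h2
    linarith
  -- choose the index maps
  choose! k₀ hk₀ using hleast
  -- one lattice witness per layer
  choose x y hxy using hlayer
  have hab : ∀ t, barlowPos 1 (Real.sqrt (2 / 3)) σ (k₀ t) (x (k₀ t) + t 0) (y (k₀ t) + t 1) = vertex (k₀ t) + uv t := by
    intro t
    rw [hxy (k₀ t), huv]
    exact (barlowPos_add_inplane 1 (Real.sqrt (2 / 3)) σ (k₀ t) (x (k₀ t)) (y (k₀ t)) (t 0) (t 1)).symm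
  refine ⟨k₀, fun t => x (k₀ t) + t 0, fun t => y (k₀ t) + t 1, fun t ht' => ?_⟩
  obtain ⟨hP, hmin⟩ := hk₀ t ht'
  have heq : barlowPos 1 (Real.sqrt (2 / 3)) σ (k₀ t) (x (k₀ t) + t 0) (y (k₀ t) + t 1) = vertex (k₀ t) + uv t := hab t
  obtain ⟨kw, h1', h2', h3'⟩ := hwin t ht'
  have h1 : H ≤ ht (vertex kw + uv t) := h1'
  have h2 : ht (vertex kw + uv t) ≤ H + 1 := h2'
  have h3 : Real.sqrt ((L (vertex kw + uv t) + s₀) 0 ^ 2 + (L (vertex kw + uv t) + s₀) 1 ^ 2) ≤ ρw := h3'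
  have hk₀le : k₀ t ≤ kw := hmin kw h1
  obtain ⟨n, hn⟩ := Int.eq_ofNat_of_zero_le (sub_nonneg.2 hk₀le)
  have hkw : kw = k₀ t + n := by omega
  have hmono := height_vertex_mono L s₀ z ms vertex hδ hsucc (uv t) (k₀ t) n
  rw [← hkw] at hmono
  -- n δ ≤ 1
  have hnδ : (n : ℝ) * δ ≤ 1 := by simp only [hht] at hP hmono h2; linarith
  have hn_le : (n : ℝ) ≤ 1 / δ := by rw [le_div_iff₀ hδ0]; exact hnδ
  refine ⟨heq, ?_, ?_, ?_, ?_, ?_⟩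
  · rw [heq]; exact hP
  · rw [heq]
    have h0 : (0 : ℝ) ≤ n * δ := by positivity
    have : ht (vertex (k₀ t) + uv t) ≤ ht (vertex kw + uv t) := by simp only [hht] at hmono ⊢; linarith
    exact this.trans h2
  · -- the predecessor is below H by minimality
    rw [heq]
    have hprev : vertex (k₀ t) + uv t - ms (k₀ t - 1) = vertex (k₀ t - 1) + uv t := by
      have := hsucc (k₀ t - 1); rw [sub_add_cancel] at this; rw [this]; abel
    rw [hprev]
    by_contra hge
    push Not at hge
    have := hmin (k₀ t - 1) hge
    omega
  · -- lateral radius: within n ≤ 1/δ unit steps of the window vertex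
    rw [heq]
    have hdist : dist (L (vertex (k₀ t) + uv t) + s₀) (L (vertex kw + uv t) + s₀) ≤ n := by
      rw [dist_eq_norm, show L (vertex (k₀ t) + uv t) + s₀ - (L (vertex kw + uv t) + s₀) = L (vertex (k₀ t) + uv t) - L (vertex kw + uv t)
        by abel, ← map_sub, LinearIsometryEquiv.norm_map, show vertex (k₀ t) + uv t - (vertex kw + uv t) = vertex (k₀ t) - vertex kw by abel,
        hkw]
      -- ‖vertex k − vertex (k+n)‖ ≤ n
      have : ∀ m : ℕ, ‖vertex (k₀ t) - vertex (k₀ t + m)‖ ≤ m := by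
        intro m
        induction m with
        | zero => simp
        | succ m ih =>
          rw [show k₀ t + ((m + 1 : ℕ) : ℤ) = k₀ t + (m : ℤ) + 1 by push_cast; ring, hsucc,
            show vertex (k₀ t) - (vertex (k₀ t + ↑m) + ms (k₀ t + ↑m)) = (vertex (k₀ t) - vertex (k₀ t + ↑m)) - ms (k₀ t + ↑m) by abel]
          calc _ ≤ ‖vertex (k₀ t) - vertex (k₀ t + ↑m)‖ + ‖ms (k₀ t + ↑m)‖ := norm_sub_le _ _
            _ ≤ m + 1 := by rw [hms]; linarith
            _ = ((m + 1 : ℕ) : ℝ) := by push_cast; ring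
      exact this n
    have hr := lateral_radius_le_add_dist (L (vertex (k₀ t) + uv t) + s₀) (L (vertex kw + uv t) + s₀)
    linarith
  · intro t' _ hpt
    obtain ⟨hk, ha, hb⟩ := barlowPos_injective σ hpt
    dsimp only at ha hb
    rw [hk] at ha hb
    have ht0 : t 0 = t' 0 := by omega
    have ht1 : t 1 = t' 1 := by omega
    funext r
    fin_cases r
    · exact ht0
    · exact ht1

end Line

end Summit.Ventures.Crystal3D.Theorems

end
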